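import Summits.RiemannHypothesis.RiemannHypothesis.Theorems.ThetaTier1Atoms
import Summits.RiemannHypothesis.RiemannHypothesis.Theorems.WeilColumnThetaWitness
import Mathlib.NumberTheory.ZetaValues
import Mathlib.Analysis.Real.Pi.Bounds
import Mathlib.Analysis.Complex.ExponentialBounds
import Mathlib.Analysis.PSeries
import HarnessLib

/-!
# THETA tier-1 — the CONSTANTS `ζ(4)`, `ζ(5)`, `Σ Λ(n) n⁻⁵` against the checker's stand-ins (cc-s2-1, WEIL typing lane;
RH-FREE bookkeeping)

Every tier-1 row has B-spline order `m = 4`; the bridge from the kernel certificate to cc-s2-3's interface `ThetaParams`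
(`ThetaTier1Bridge`) needs `zetaTail 5 ≤ zetaHi 5`, `zetaTail 4 ≤ zetaHi 4`, `vonMangoldtSum 5 ≤ pLamHi 5`.  Proved here:

* `zetaTail_four_eq : Σ_{n≥1} n⁻⁴ = π⁴/90` (Mathlib `hasSum_zeta_four`), `zetaTail_four_le : … ≤ 1.0824` (`Real.pi_lt_d6`);
* `zetaTail_five_le : Σ_{n≥1} n⁻⁵ ≤ 1.0370` — ten exact terms, tail `Σ_{n≥11} n⁻⁵ ≤ (1/11)(π⁴/90 − Σ_{n≤10} n⁻⁴)`;
* `vonMangoldtSum_five_le : Σ Λ(n) n⁻⁵ ≤ 1/32` — `Λ(n) ≤ log n` (Mathlib), `log 2 < 0.6931471808`, `log 3 ≤ log 2 + 1/2`,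
  `log n ≤ 2 log 2 + (n/4 − 1)` (`4 ≤ n ≤ 7`), `Λ(n) n⁻⁵ ≤ n⁻⁴` beyond, tail `Σ_{n≥8} n⁻⁴ = π⁴/90 − Σ_{n≤7} n⁻⁴`.

Nothing here bears on the truth of RH.
-/

set_option linter.dupNamespace false  -- the mandated namespace repeats `RiemannHypothesis`
set_option autoImplicit false

namespace Summit.RiemannHypothesis.RiemannHypothesis.Theorems.ThetaTier1

open Summit.RiemannHypothesis.RiemannHypothesis.Theorems.WeilColumn.ThetaMellin

/-! ## `ζ(4)` and `ζ(5)` -/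

/-- `pi_pow_four_div_ninety_lt` (constants bookkeeping). [this cell] -/
theorem pi_pow_four_div_ninety_lt : Real.pi ^ 4 / 90 < 1.082324 := by
  have h1 := Real.pi_lt_d6
  have h0 := Real.pi_pos.le
  have h4 : Real.pi ^ 4 < 3.141593 ^ 4 := pow_lt_pow_left₀ h1 h0 (by norm_num)
  have : (3.141593 : ℝ) ^ 4 / 90 < 1.082324 := by norm_num
  linarith [div_lt_div_of_pos_right h4 (by norm_num : (0:ℝ) < 90)]

/-- `summable_inv_pow'` (constants bookkeeping). [this cell] -/
theorem summable_inv_pow' {s : ℕ} (hs : 2 ≤ s) : Summable (fun n : ℕ => (1 : ℝ) / (n : ℝ) ^ s) :=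
  Real.summable_one_div_nat_pow.2 (by omega)

/-- `tsum_inv_pow_four_add` (constants bookkeeping). [this cell] -/
theorem tsum_inv_pow_four_add (k : ℕ) :
    ∑' n : ℕ, (1 : ℝ) / ((n + k : ℕ) : ℝ) ^ 4 = Real.pi ^ 4 / 90 - ∑ i ∈ Finset.range k, (1 : ℝ) / (i : ℝ) ^ 4 :=
  ((hasSum_nat_add_iff' (f := fun n : ℕ => (1 : ℝ) / (n : ℝ) ^ 4) k).2 hasSum_zeta_four).tsum_eq

/-- `zeta5_tail_term_le` (constants bookkeeping). [this cell] -/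
theorem zeta5_tail_term_le (n : ℕ) :
    (1 : ℝ) / ((n + 11 : ℕ) : ℝ) ^ 5 ≤ (1 / 11 : ℝ) * ((1 : ℝ) / ((n + 11 : ℕ) : ℝ) ^ 4) := by
  have hn : (11 : ℝ) ≤ ((n + 11 : ℕ) : ℝ) := by exact_mod_cast (by omega : 11 ≤ n + 11)
  have hpos : (0 : ℝ) < ((n + 11 : ℕ) : ℝ) := by exact_mod_cast (by omega : 0 < n + 11)
  have h4p : (0 : ℝ) < ((n + 11 : ℕ) : ℝ) ^ 4 := pow_pos hpos 4
  have key : 11 * ((n + 11 : ℕ) : ℝ) ^ 4 ≤ ((n + 11 : ℕ) : ℝ) ^ 5 :=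
    calc 11 * ((n + 11 : ℕ) : ℝ) ^ 4 ≤ ((n + 11 : ℕ) : ℝ) * ((n + 11 : ℕ) : ℝ) ^ 4 :=
          mul_le_mul_of_nonneg_right hn h4p.le
      _ = ((n + 11 : ℕ) : ℝ) ^ 5 := by ring
  rw [div_mul_div_comm, one_mul, div_le_div_iff₀ (pow_pos hpos 5) (by linarith)]
  linarith

set_option maxHeartbeats 400000 in
/-- `zeta5_tail_le` (constants bookkeeping). [this cell] -/
theorem zeta5_tail_le (_hg : Summable (fun n : ℕ => (1 : ℝ) / ((n + 1 : ℕ) : ℝ) ^ 5)) :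
    ∑' n : ℕ, (1 : ℝ) / ((n + 10 + 1 : ℕ) : ℝ) ^ 5 ≤ (1 / 11 : ℝ) * ∑' n : ℕ, (1 : ℝ) / ((n + 11 : ℕ) : ℝ) ^ 4 := by
  have h4 : Summable (fun n : ℕ => (1 : ℝ) / ((n + 11 : ℕ) : ℝ) ^ 4) :=
    (summable_nat_add_iff 11).2 (summable_inv_pow' (s := 4) (by norm_num))
  have h4' : Summable (fun n : ℕ => (1 / 11 : ℝ) * ((1 : ℝ) / ((n + 11 : ℕ) : ℝ) ^ 4)) := h4.mul_left _
  have hg' : Summable (fun n : ℕ => (1 : ℝ) / ((n + 11 : ℕ) : ℝ) ^ 5) :=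
    (summable_nat_add_iff 11).2 (summable_inv_pow' (s := 5) (by norm_num))
  rw [← h4.tsum_mul_left (1 / 11)]
  have e : (fun n : ℕ => (1 : ℝ) / ((n + 10 + 1 : ℕ) : ℝ) ^ 5) = (fun n : ℕ => (1 : ℝ) / ((n + 11 : ℕ) : ℝ) ^ 5) := by
    funext n; rw [show n + 10 + 1 = n + 11 by omega]
  rw [e]
  exact Summable.tsum_le_tsum zeta5_tail_term_le hg' h4'

/-- `zeta5_head_le` (constants bookkeeping). [this cell] -/
theorem zeta5_head_le : ∑ i ∈ Finset.range 10, (1 : ℝ) / ((i + 1 : ℕ) : ℝ) ^ 5 ≤ 1.0369074 := by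
  norm_num [Finset.sum_range_succ]

/-- `zeta4_head11_ge` (constants bookkeeping). [this cell] -/
theorem zeta4_head11_ge : (1.0820365 : ℝ) ≤ ∑ i ∈ Finset.range 11, (1 : ℝ) / (i : ℝ) ^ 4 := by
  norm_num [Finset.sum_range_succ]

open ArithmeticFunction

/-- `lam_le_inv_pow4` (constants bookkeeping). [this cell] -/
theorem lam_le_inv_pow4 (n : ℕ) : (vonMangoldt n : ℝ) / (n : ℝ) ^ 5 ≤ 1 / (n : ℝ) ^ 4 := by
  rcases Nat.eq_zero_or_pos n with rfl | hn
  · rw [ArithmeticFunction.map_zero]; simp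
  have hpos : (0 : ℝ) < n := by exact_mod_cast hn
  have hlog : Real.log n ≤ n - 1 := Real.log_le_sub_one_of_pos hpos
  have hΛ : (vonMangoldt n : ℝ) ≤ Real.log n := vonMangoldt_le_log
  have h4p : (0 : ℝ) < (n : ℝ) ^ 4 := pow_pos hpos 4
  rw [div_le_div_iff₀ (pow_pos hpos 5) h4p]
  calc (vonMangoldt n : ℝ) * (n : ℝ) ^ 4 ≤ (n : ℝ) * (n : ℝ) ^ 4 :=
        mul_le_mul_of_nonneg_right (by linarith) h4p.le
    _ = 1 * (n : ℝ) ^ 5 := by ring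

/-- `lam_summable` (constants bookkeeping). [this cell] -/
theorem lam_summable : Summable (fun n : ℕ => (vonMangoldt n : ℝ) / (n : ℝ) ^ 5) :=
  Summable.of_nonneg_of_le (fun n => div_nonneg vonMangoldt_nonneg (pow_nonneg (Nat.cast_nonneg n) 5))
    lam_le_inv_pow4 (summable_inv_pow' (by norm_num))

set_option maxHeartbeats 400000 in
/-- `lam_tail_le` (constants bookkeeping). [this cell] -/
theorem lam_tail_le : ∑' n : ℕ, (vonMangoldt (n + 8) : ℝ) / ((n + 8 : ℕ) : ℝ) ^ 5 ≤
    Real.pi ^ 4 / 90 - ∑ i ∈ Finset.range 8, (1 : ℝ) / (i : ℝ) ^ 4 := by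
  rw [← tsum_inv_pow_four_add 8]
  exact Summable.tsum_le_tsum (fun n => lam_le_inv_pow4 (n + 8)) ((summable_nat_add_iff 8).2 lam_summable)
    ((summable_nat_add_iff 8).2 (summable_inv_pow' (by norm_num)))

/-- `log_le_head` (constants bookkeeping). [this cell] -/
theorem log_le_head (n : ℕ) (hn : 1 ≤ n) : Real.log n ≤ 2 * Real.log 2 + ((n : ℝ) / 4 - 1) := by
  have hpos : (0 : ℝ) < n := by exact_mod_cast hn
  have hlog4 : Real.log 4 = 2 * Real.log 2 := by
    rw [show (4 : ℝ) = 2 ^ 2 by norm_num, Real.log_pow]; norm_num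
  have hn4 : (0 : ℝ) < (n : ℝ) / 4 := by linarith
  have hsplit : Real.log n = Real.log 4 + Real.log ((n : ℝ) / 4) := by
    rw [← Real.log_mul (by norm_num) hn4.ne']; congr 1; ring
  have hle := Real.log_le_sub_one_of_pos hn4
  linarith

/-- `lam_head_le` (constants bookkeeping). [this cell] -/
theorem lam_head_le (n : ℕ) (hn : 1 ≤ n) :
    (vonMangoldt n : ℝ) / (n : ℝ) ^ 5 ≤ (2 * Real.log 2 + ((n : ℝ) / 4 - 1)) / (n : ℝ) ^ 5 := by
  have hpos : (0 : ℝ) < n := by exact_mod_cast hn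
  exact div_le_div_of_nonneg_right (vonMangoldt_le_log.trans (log_le_head n hn)) (pow_nonneg hpos.le 5)

/-- `log_three_le` (constants bookkeeping). [this cell] -/
theorem log_three_le : Real.log 3 ≤ Real.log 2 + 1 / 2 := by
  have h : Real.log 3 = Real.log 2 + Real.log (3 / 2) := by
    rw [← Real.log_mul (by norm_num) (by norm_num)]; norm_num
  have := Real.log_le_sub_one_of_pos (show (0:ℝ) < 3 / 2 by norm_num)
  rw [h]; linarith

/-- `lam_two_le` (constants bookkeeping). [this cell] -/
theorem lam_two_le : (vonMangoldt 2 : ℝ) / ((2 : ℕ) : ℝ) ^ 5 ≤ Real.log 2 / 32 := by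
  have h : (vonMangoldt 2 : ℝ) ≤ Real.log 2 := by exact_mod_cast (vonMangoldt_le_log (n := 2))
  norm_num
  linarith

/-- `lam_three_le` (constants bookkeeping). [this cell] -/
theorem lam_three_le : (vonMangoldt 3 : ℝ) / ((3 : ℕ) : ℝ) ^ 5 ≤ (Real.log 2 + 1 / 2) / 243 := by
  have h : (vonMangoldt 3 : ℝ) ≤ Real.log 3 := by exact_mod_cast (vonMangoldt_le_log (n := 3))
  have h3 := log_three_le
  norm_num
  linarith

/-- `zeta4_head8_ge` (constants bookkeeping). [this cell] -/
theorem zeta4_head8_ge : (1.08154 : ℝ) ≤ ∑ i ∈ Finset.range 8, (1 : ℝ) / (i : ℝ) ^ 4 := by norm_num [Finset.sum_range_succ]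

/-- `lam_five_le` (constants bookkeeping). [this cell] -/
theorem lam_five_le : ∑' n : ℕ, (vonMangoldt n : ℝ) / (n : ℝ) ^ 5 ≤ 1 / 32 := by
  rw [← lam_summable.sum_add_tsum_nat_add 8]
  have htail := lam_tail_le
  have h0 : (vonMangoldt 0 : ℝ) / ((0 : ℕ) : ℝ) ^ 5 = 0 := by rw [ArithmeticFunction.map_zero]; simp
  have h1 : (vonMangoldt 1 : ℝ) / ((1 : ℕ) : ℝ) ^ 5 = 0 := by rw [vonMangoldt_apply_one]; simp
  have b2 := lam_two_le
  have b3 := lam_three_le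
  have b4 := lam_head_le 4 (by norm_num)
  have b5 := lam_head_le 5 (by norm_num)
  have b6 := lam_head_le 6 (by norm_num)
  have b7 := lam_head_le 7 (by norm_num)
  have hl2 := Real.log_two_lt_d9
  simp only [Finset.sum_range_succ, Finset.sum_range_zero, zero_add, Nat.cast_ofNat] at htail ⊢
  rw [h0, h1]
  norm_num at b2 b3 b4 b5 b6 b7 htail ⊢
  linarith [pi_pow_four_div_ninety_lt, htail, b2, b3, b4, b5, b6, b7, hl2]

/-- `zetaTail s = Σ' n, 1/n^s` shifted by one (the `n = 0` term of the latter is `0`). [folklore] -/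
theorem zetaTail_eq_tsum_succ (s : ℕ) :
    ThetaParams.zetaTail s = ∑' n : ℕ, (1 : ℝ) / ((n + 1 : ℕ) : ℝ) ^ s := by
  simp only [ThetaParams.zetaTail, Nat.cast_add, Nat.cast_one]

/-- **`Σ_{n≥1} n⁻⁴ = π⁴/90`.** [folklore; Mathlib `hasSum_zeta_four`] -/
theorem zetaTail_four_eq : ThetaParams.zetaTail 4 = Real.pi ^ 4 / 90 := by
  rw [zetaTail_eq_tsum_succ]
  have h := tsum_inv_pow_four_add 1
  simp only [Finset.sum_range_one, Nat.cast_zero, ne_eq, OfNat.ofNat_ne_zero, not_false_eq_true, zero_pow,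
    div_zero, sub_zero] at h
  exact h

/-- **`ζ(4)` bound**: `Σ_{n≥1} n⁻⁴ ≤ zetaHi 4 = 1.0824`. [this cell] -/
theorem zetaTail_four_le : ThetaParams.zetaTail 4 ≤ ((zetaHi 4 : ℚ) : ℝ) := by
  rw [zetaTail_four_eq]
  have : ((zetaHi 4 : ℚ) : ℝ) = 1.0824 := by norm_num [zetaHi]
  rw [this]
  linarith [pi_pow_four_div_ninety_lt]

/-- **`ζ(5)` bound**: `Σ_{n≥1} n⁻⁵ ≤ zetaHi 5 = 1.0370`. [this cell] -/
theorem zetaTail_five_le : ThetaParams.zetaTail 5 ≤ ((zetaHi 5 : ℚ) : ℝ) := by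
  rw [zetaTail_eq_tsum_succ]
  have hg : Summable (fun n : ℕ => (1 : ℝ) / ((n + 1 : ℕ) : ℝ) ^ 5) :=
    (summable_nat_add_iff 1).2 (summable_inv_pow' (s := 5) (by norm_num))
  rw [← hg.sum_add_tsum_nat_add 10]
  have htail := zeta5_tail_le hg
  rw [tsum_inv_pow_four_add 11] at htail
  have : ((zetaHi 5 : ℚ) : ℝ) = 1.037 := by norm_num [zetaHi]
  rw [this]
  linarith [pi_pow_four_div_ninety_lt, htail, zeta5_head_le, zeta4_head11_ge]

/-- **`Λ` bound**: `Σ_n Λ(n) n⁻⁵ ≤ pLamHi 5 = 1/32`. [this cell] -/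
theorem vonMangoldtSum_five_le : ThetaParams.vonMangoldtSum 5 ≤ ((pLamHi 5 : ℚ) : ℝ) := by
  have hp : ((pLamHi 5 : ℚ) : ℝ) = 1 / 32 := by norm_num [pLamHi]
  rw [hp, ThetaParams.vonMangoldtSum]
  exact lam_five_le

end Summit.RiemannHypothesis.RiemannHypothesis.Theorems.ThetaTier1
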